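import Mathlib.Analysis.SpecialFunctions.Trigonometric.InverseDeriv
import Mathlib.Analysis.SpecialFunctions.Sqrt
import Mathlib.MeasureTheory.Integral.IntervalIntegral.FundThmCalculus
import Mathlib.MeasureTheory.Integral.IntervalIntegral.IntegrationByParts
import HarnessLib

/-!
# One-variable calculus for the fourth virial coefficient of hard discs

Elementary definite integrals used in the computation of the ring, diamond and complete-star
Mayer diagrams of `B₄` for hard discs (`HardDiscVirial.lean`, fact `ClisbyMcCoy2004_B4_hardDiscs`;
the values are Rowlinson's / Hemmer's 1964, quoted in [ClisbyMccoy2004, §1]). Everything here is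
[folklore] calculus: explicit antiderivatives verified by differentiation, the fundamental theorem
of calculus (`intervalIntegral.integral_eq_sub_of_hasDerivAt`) and one substitution
(`intervalIntegral.integral_comp_mul_deriv`). No definitions, no named facts.

* Lens area of two unit discs at distance `ρ`: `A(ρ) = 2 arccos(ρ/2) − ρ√(1 − ρ²/4)`. With
  `ρ = 2cos(u/2)` one has `A = u − sin u`, `ρ dρ = −sin u du`, so
  `∫₀² ρ A(ρ)² dρ = ∫₀^π sin u (u − sin u)² du = π²/2 − 8/3` (ring diagram) and
  `∫₀¹ ρ A(ρ)² dρ = ∫_{2π/3}^π sin u (u − sin u)² du = π²/2 − √3π/2 − 5/12` (diamond).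
* `Φ(y) = (y√(1−y²) + arcsin y)/2`, `Φ' = √(1−y²)`; the "corner section" integral
  `∫_{1/2}^{Y} (√(1−y²) + q₁ − √(1−(y−q₂)²)) dy` in closed form, its trigonometric evaluation at
  `q = 2cos α (cos θ, sin θ)`, `Y = sin(θ+α)`, and the two remaining angular integrals
  (`θ` over `(π/2−α, 5π/6−α)`, then `α` over `(π/3, π/2)` against `2 sin 2α`), giving the corner
  constant `1/16 + √3π/48 − π²/72` of the complete star.
-/

noncomputable section

open _root_.MeasureTheory _root_.Set _root_.Real intervalIntegral

namespace Literature.MathematicalPhysics.StatisticalMechanics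

namespace HardDiscB4

/-! ### The ring/diamond radial integral `∫ ρ A(ρ)² dρ` -/

/-- Antiderivative of `sin u (u − sin u)²`:
`P(u) = −u² cos u + 2u sin u + cos u − u²/2 + u sin u cos u + (2cos²u − 1)/4 + cos³u/3`.
[folklore] -/
theorem hasDerivAt_ringPrim (u : ℝ) :
    HasDerivAt (fun u : ℝ => -u ^ 2 * cos u + 2 * u * sin u + cos u - u ^ 2 / 2
        + u * sin u * cos u + (2 * cos u ^ 2 - 1) / 4 + cos u ^ 3 / 3)
      (sin u * (u - sin u) ^ 2) u := by
  have hs := hasDerivAt_sin u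
  have hc := hasDerivAt_cos u
  have hid := hasDerivAt_id' u
  have h2 : HasDerivAt (fun u : ℝ => u ^ 2) (2 * u) u := by simpa using hasDerivAt_pow 2 u
  have hc2 : HasDerivAt (fun u : ℝ => cos u ^ 2) (2 * cos u * (-sin u)) u := by
    simpa using hc.fun_pow 2
  have hc3 : HasDerivAt (fun u : ℝ => cos u ^ 3) (3 * cos u ^ 2 * (-sin u)) u := by
    simpa using hc.fun_pow 3
  have key := ((((((h2.fun_neg.fun_mul hc).fun_add ((hid.const_mul 2).fun_mul hs)).fun_add hc).fun_sub
    (h2.div_const 2)).fun_add ((hid.fun_mul hs).fun_mul hc)).fun_add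
    (((hc2.const_mul 2).sub_const 1).div_const 4)).fun_add (hc3.div_const 3)
  refine key.congr_deriv ?_
  linear_combination (u - sin u) * sin_sq_add_cos_sq u

/-- `∫₀^π sin u (u − sin u)² du = π²/2 − 8/3`. [folklore] -/
theorem integral_ring_trig :
    ∫ u in (0:ℝ)..π, sin u * (u - sin u) ^ 2 = π ^ 2 / 2 - 8 / 3 := by
  rw [integral_eq_sub_of_hasDerivAt (fun u _ => hasDerivAt_ringPrim u)
    (Continuous.intervalIntegrable (by fun_prop) _ _)]
  simp only [cos_pi, sin_pi, cos_zero, sin_zero]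
  ring

/-- `∫_{2π/3}^π sin u (u − sin u)² du = π²/2 − √3π/2 − 5/12`. [folklore] -/
theorem integral_diamond_trig :
    ∫ u in (2 * π / 3 : ℝ)..π, sin u * (u - sin u) ^ 2 = π ^ 2 / 2 - √3 * π / 2 - 5 / 12 := by
  rw [integral_eq_sub_of_hasDerivAt (fun u _ => hasDerivAt_ringPrim u)
    (Continuous.intervalIntegrable (by fun_prop) _ _)]
  have hc : cos (2 * π / 3) = -(1 / 2) := by
    rw [show (2 * π / 3 : ℝ) = π - π / 3 by ring, cos_pi_sub, cos_pi_div_three]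
  have hs : sin (2 * π / 3) = √3 / 2 := by
    rw [show (2 * π / 3 : ℝ) = π - π / 3 by ring, sin_pi_sub, sin_pi_div_three]
  simp only [cos_pi, sin_pi, hc, hs]
  ring

/-- Substitution `ρ = 2cos(u/2)`: for `0 ≤ b ≤ π`,
`∫₀^{2cos(b/2)} ρ A(ρ)² dρ = ∫_b^π sin u (u − sin u)² du`, `A(ρ) = 2 arccos(ρ/2) − ρ√(1 − ρ²/4)`.
[folklore] -/
theorem integral_rho_lensSq_eq {b : ℝ} (hb0 : 0 ≤ b) (hbπ : b ≤ π) :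
    ∫ ρ in (0:ℝ)..(2 * cos (b / 2)), ρ * (2 * arccos (ρ / 2) - ρ * √(1 - ρ ^ 2 / 4)) ^ 2 =
      ∫ u in b..π, sin u * (u - sin u) ^ 2 := by
  have hderiv : ∀ x ∈ uIcc π b, HasDerivAt (fun u : ℝ => 2 * cos (u / 2)) (-sin (x / 2)) x := by
    intro x _
    have h := ((hasDerivAt_cos (x / 2)).comp x ((hasDerivAt_id' x).div_const 2)).const_mul 2
    refine h.congr_deriv ?_
    ring
  have hcont : ContinuousOn (fun x : ℝ => -sin (x / 2)) (uIcc π b) :=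
    Continuous.continuousOn (by fun_prop)
  have hg : Continuous (fun ρ : ℝ => ρ * (2 * arccos (ρ / 2) - ρ * √(1 - ρ ^ 2 / 4)) ^ 2) := by
    fun_prop
  have key := integral_comp_mul_deriv (f := fun u : ℝ => 2 * cos (u / 2))
    (f' := fun x : ℝ => -sin (x / 2))
    (g := fun ρ : ℝ => ρ * (2 * arccos (ρ / 2) - ρ * √(1 - ρ ^ 2 / 4)) ^ 2) hderiv hcont hg
  have h0 : 2 * cos (π / 2) = 0 := by rw [cos_pi_div_two, mul_zero]
  simp only [Function.comp_def] at key
  rw [h0] at key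
  rw [← key, integral_symm, ← intervalIntegral.integral_neg]
  apply integral_congr
  intro x hx
  rw [uIcc_of_le hbπ] at hx
  have hx0 : 0 ≤ x / 2 := by linarith [hx.1]
  have hxπ : x / 2 ≤ π := by linarith [hx.2, pi_pos]
  have hsin : 0 ≤ sin (x / 2) := sin_nonneg_of_nonneg_of_le_pi hx0 hxπ
  have h1 : arccos (2 * cos (x / 2) / 2) = x / 2 := by
    rw [show 2 * cos (x / 2) / 2 = cos (x / 2) by ring, arccos_cos hx0 hxπ]
  have h2 : √(1 - (2 * cos (x / 2)) ^ 2 / 4) = sin (x / 2) := by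
    rw [show 1 - (2 * cos (x / 2)) ^ 2 / 4 = sin (x / 2) ^ 2 by
      linear_combination -(sin_sq_add_cos_sq (x / 2)), sqrt_sq hsin]
  have h3 : sin x = 2 * sin (x / 2) * cos (x / 2) := by
    rw [← sin_two_mul]; congr 1; ring
  simp only [h1, h2, h3]
  ring

/-- Ring radial integral: `∫₀² ρ A(ρ)² dρ = π²/2 − 8/3`. [folklore] -/
theorem integral_rho_lensSq_two :
    ∫ ρ in (0:ℝ)..2, ρ * (2 * arccos (ρ / 2) - ρ * √(1 - ρ ^ 2 / 4)) ^ 2 = π ^ 2 / 2 - 8 / 3 := by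
  have h := integral_rho_lensSq_eq le_rfl pi_pos.le
  rw [zero_div, cos_zero, mul_one] at h
  rw [h, integral_ring_trig]

/-- Diamond radial integral: `∫₀¹ ρ A(ρ)² dρ = π²/2 − √3π/2 − 5/12`. [folklore] -/
theorem integral_rho_lensSq_one :
    ∫ ρ in (0:ℝ)..1, ρ * (2 * arccos (ρ / 2) - ρ * √(1 - ρ ^ 2 / 4)) ^ 2 =
      π ^ 2 / 2 - √3 * π / 2 - 5 / 12 := by
  have h := integral_rho_lensSq_eq (b := 2 * π / 3) (by positivity) (by linarith [pi_pos])
  rw [show 2 * π / 3 / 2 = π / 3 by ring, cos_pi_div_three, show (2 : ℝ) * (1 / 2) = 1 by norm_num]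
    at h
  rw [h, integral_diamond_trig]

/-! ### `Φ(y) = (y√(1−y²) + arcsin y)/2`, an antiderivative of `√(1−y²)` -/

/-- `Φ' = √(1 − y²)` on `(−1, 1)`. [folklore] -/
theorem hasDerivAt_Phi {y : ℝ} (h1 : -1 < y) (h2 : y < 1) :
    HasDerivAt (fun y : ℝ => (y * √(1 - y ^ 2) + arcsin y) / 2) (√(1 - y ^ 2)) y := by
  have hs : 0 < 1 - y ^ 2 := by nlinarith
  have hd : HasDerivAt (fun y : ℝ => 1 - y ^ 2) (-(2 * y)) y := by
    simpa using (hasDerivAt_pow 2 y).const_sub 1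
  have key := (((hasDerivAt_id' y).fun_mul (hd.sqrt hs.ne')).fun_add
    (hasDerivAt_arcsin h1.ne' h2.ne)).div_const 2
  refine key.congr_deriv ?_
  have hsq := sq_sqrt hs.le
  have hne : √(1 - y ^ 2) ≠ 0 := (sqrt_pos.mpr hs).ne'
  field_simp
  linear_combination -hsq

/-- `∫_a^b √(1 − (y − c)²) dy = Φ(b − c) − Φ(a − c)` for `c − 1 ≤ a ≤ b ≤ c + 1`. [folklore] -/
theorem integral_sqrt_one_sub_sq_shift {a b c : ℝ} (hab : a ≤ b) (ha : c - 1 ≤ a) (hb : b ≤ c + 1) :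
    ∫ y in a..b, √(1 - (y - c) ^ 2) =
      ((b - c) * √(1 - (b - c) ^ 2) + arcsin (b - c)) / 2
        - ((a - c) * √(1 - (a - c) ^ 2) + arcsin (a - c)) / 2 := by
  have hderiv : ∀ y ∈ Ioo a b, HasDerivAt
      (fun y : ℝ => ((y - c) * √(1 - (y - c) ^ 2) + arcsin (y - c)) / 2)
      (√(1 - (y - c) ^ 2)) y := by
    intro y hy
    have h1 : -1 < y - c := by linarith [hy.1]
    have h2 : y - c < 1 := by linarith [hy.2]
    have h := (hasDerivAt_Phi h1 h2).comp y ((hasDerivAt_id' y).sub_const c)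
    simpa [Function.comp_def] using h
  have hcont : ContinuousOn
      (fun y : ℝ => ((y - c) * √(1 - (y - c) ^ 2) + arcsin (y - c)) / 2) (Icc a b) :=
    Continuous.continuousOn (by fun_prop)
  have hint : IntervalIntegrable (fun y : ℝ => √(1 - (y - c) ^ 2)) volume a b :=
    Continuous.intervalIntegrable (by fun_prop) _ _
  rw [integral_eq_sub_of_hasDerivAt_of_le hab hcont hderiv hint]

/-- `∫_a^b √(1 − y²) dy = Φ(b) − Φ(a)` for `−1 ≤ a ≤ b ≤ 1`. [folklore] -/
theorem integral_sqrt_one_sub_sq' {a b : ℝ} (hab : a ≤ b) (ha : -1 ≤ a) (hb : b ≤ 1) :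
    ∫ y in a..b, √(1 - y ^ 2) =
      (b * √(1 - b ^ 2) + arcsin b) / 2 - (a * √(1 - a ^ 2) + arcsin a) / 2 := by
  have h := integral_sqrt_one_sub_sq_shift (c := 0) hab (by linarith) (by linarith)
  simpa using h

/-- The corner-section integral in closed form:
`∫_{1/2}^{Y} (√(1−y²) + q₁ − √(1−(y−q₂)²)) dy = Φ(Y) − Φ(1/2) + q₁(Y − 1/2) − Φ(Y−q₂) + Φ(1/2−q₂)`
for `1/2 ≤ Y ≤ 1`, `0 ≤ q₂ ≤ 3/2`. [folklore] -/
theorem integral_cornerSection {q₁ q₂ Y : ℝ} (hY : 1 / 2 ≤ Y) (hY1 : Y ≤ 1) (hq₂ : 0 ≤ q₂)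
    (hq₂' : q₂ ≤ 3 / 2) :
    ∫ y in (1 / 2 : ℝ)..Y, (√(1 - y ^ 2) + q₁ - √(1 - (y - q₂) ^ 2)) =
      (Y * √(1 - Y ^ 2) + arcsin Y) / 2 - (1 / 2 * √(1 - (1 / 2) ^ 2) + arcsin (1 / 2)) / 2
        + q₁ * (Y - 1 / 2)
        - (((Y - q₂) * √(1 - (Y - q₂) ^ 2) + arcsin (Y - q₂)) / 2
          - ((1 / 2 - q₂) * √(1 - (1 / 2 - q₂) ^ 2) + arcsin (1 / 2 - q₂)) / 2) := by
  have i1 : IntervalIntegrable (fun y : ℝ => √(1 - y ^ 2)) volume (1 / 2) Y :=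
    Continuous.intervalIntegrable (by fun_prop) _ _
  have i2 : IntervalIntegrable (fun _ : ℝ => q₁) volume (1 / 2) Y := intervalIntegrable_const
  have i3 : IntervalIntegrable (fun y : ℝ => √(1 - (y - q₂) ^ 2)) volume (1 / 2) Y :=
    Continuous.intervalIntegrable (by fun_prop) _ _
  have i12 : IntervalIntegrable (fun y : ℝ => √(1 - y ^ 2) + q₁) volume (1 / 2) Y := i1.add i2
  rw [integral_sub i12 i3, integral_add i1 i2, intervalIntegral.integral_const,
    integral_sqrt_one_sub_sq' hY (by norm_num) hY1,
    integral_sqrt_one_sub_sq_shift hY (by linarith) (by linarith)]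
  simp only [smul_eq_mul]
  ring

/-! ### Trigonometric evaluation of the corner section -/

/-- `Φ(sin γ) = (π − γ − sin γ cos γ)/2` for `γ ∈ [π/2, π]`. [folklore] -/
theorem Phi_sin_of_ge {γ : ℝ} (h1 : π / 2 ≤ γ) (h2 : γ ≤ π) :
    (sin γ * √(1 - sin γ ^ 2) + arcsin (sin γ)) / 2 = (π - γ - sin γ * cos γ) / 2 := by
  have hc : cos γ ≤ 0 := cos_nonpos_of_pi_div_two_le_of_le h1 (by linarith [pi_pos])
  have h3 : √(1 - sin γ ^ 2) = -cos γ := by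
    rw [show 1 - sin γ ^ 2 = (-cos γ) ^ 2 by linear_combination -(sin_sq_add_cos_sq γ),
      sqrt_sq (by linarith)]
  have h4 : arcsin (sin γ) = π - γ := by
    rw [← sin_pi_sub, arcsin_sin (by linarith) (by linarith)]
  rw [h3, h4]
  ring

/-- `Φ(sin δ) = (δ + sin δ cos δ)/2` for `δ ∈ [−π/2, π/2]`. [folklore] -/
theorem Phi_sin_of_le {δ : ℝ} (h1 : -(π / 2) ≤ δ) (h2 : δ ≤ π / 2) :
    (sin δ * √(1 - sin δ ^ 2) + arcsin (sin δ)) / 2 = (δ + sin δ * cos δ) / 2 := by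
  have hc : 0 ≤ cos δ := cos_nonneg_of_neg_pi_div_two_le_of_le h1 h2
  have h3 : √(1 - sin δ ^ 2) = cos δ := by
    rw [show 1 - sin δ ^ 2 = cos δ ^ 2 by linear_combination -(sin_sq_add_cos_sq δ), sqrt_sq hc]
  rw [h3, arcsin_sin h1 h2]
  ring

/-- `Φ(1/2) = √3/8 + π/12`. [folklore] -/
theorem Phi_half : (1 / 2 * √(1 - (1 / 2 : ℝ) ^ 2) + arcsin (1 / 2)) / 2 = √3 / 8 + π / 12 := by
  have h1 : √(1 - (1 / 2 : ℝ) ^ 2) = √3 / 2 := by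
    rw [show (1 - (1 / 2 : ℝ) ^ 2) = 3 / 4 by norm_num, sqrt_div (by norm_num),
      show (4 : ℝ) = 2 ^ 2 by norm_num, sqrt_sq (by norm_num)]
  have h2 : arcsin (1 / 2 : ℝ) = π / 6 := by
    rw [← sin_pi_div_six, arcsin_sin (by linarith [pi_pos]) (by linarith [pi_pos])]
  rw [h1, h2]
  ring

/-- Trigonometric closed form of the corner section: with `q = 2cos α (cos θ, sin θ)` and
`Y = sin(θ+α)`, for `π/3 < α < π/2`, `π/2 − α < θ < 5π/6 − α`,
`Φ(Y) − Φ(1/2) + q₁(Y − 1/2) − Φ(Y − q₂) = 5π/12 − √3/8 − α + sin α cos α + cos²α sin 2θ − cos α cos θ`.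
[folklore] -/
theorem corner_closedForm {θ α : ℝ} (hα1 : π / 3 < α) (hα2 : α < π / 2) (hθ1 : π / 2 - α < θ)
    (hθ2 : θ < 5 * π / 6 - α) :
    (sin (θ + α) * √(1 - sin (θ + α) ^ 2) + arcsin (sin (θ + α))) / 2
        - (1 / 2 * √(1 - (1 / 2 : ℝ) ^ 2) + arcsin (1 / 2)) / 2
        + 2 * cos α * cos θ * (sin (θ + α) - 1 / 2)
        - ((sin (θ + α) - 2 * cos α * sin θ) * √(1 - (sin (θ + α) - 2 * cos α * sin θ) ^ 2)
            + arcsin (sin (θ + α) - 2 * cos α * sin θ)) / 2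
      = 5 * π / 12 - √3 / 8 - α + sin α * cos α + cos α ^ 2 * sin (2 * θ) - cos α * cos θ := by
  have hπ := pi_pos
  have hsub : sin (θ + α) - 2 * cos α * sin θ = sin (α - θ) := by
    rw [sin_add, sin_sub]; ring
  rw [hsub, Phi_sin_of_ge (by linarith) (by linarith), Phi_half,
    Phi_sin_of_le (by linarith) (by linarith)]
  simp only [sin_add, cos_add, sin_sub, cos_sub, sin_two_mul]
  linear_combination (sin α * cos α) * sin_sq_add_cos_sq θ

/-! ### The two angular integrals -/

/-- `cos(5π/3 − x) = cos x /2 − (√3/2) sin x`. [folklore] -/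
theorem cos_five_pi_div_three_sub (x : ℝ) : cos (5 * π / 3 - x) = 1 / 2 * cos x - √3 / 2 * sin x := by
  have hc : cos (5 * π / 3) = 1 / 2 := by
    rw [show (5 * π / 3 : ℝ) = 2 * π - π / 3 by ring, cos_two_pi_sub, cos_pi_div_three]
  have hs : sin (5 * π / 3) = -(√3 / 2) := by
    rw [show (5 * π / 3 : ℝ) = 2 * π - π / 3 by ring, sin_two_pi_sub, sin_pi_div_three]
  rw [cos_sub, hc, hs]
  ring

/-- `sin(5π/6 − x) = cos x /2 + (√3/2) sin x`. [folklore] -/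
theorem sin_five_pi_div_six_sub (x : ℝ) : sin (5 * π / 6 - x) = 1 / 2 * cos x + √3 / 2 * sin x := by
  have hs : sin (5 * π / 6) = 1 / 2 := by
    rw [show (5 * π / 6 : ℝ) = π - π / 6 by ring, sin_pi_sub, sin_pi_div_six]
  have hc : cos (5 * π / 6) = -(√3 / 2) := by
    rw [show (5 * π / 6 : ℝ) = π - π / 6 by ring, cos_pi_sub, cos_pi_div_six]
  rw [sin_sub, hs, hc]
  ring

/-- The `θ`-integral of the corner closed form over `(π/2 − α, 5π/6 − α)`. [folklore] -/
theorem integral_corner_theta (α : ℝ) :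
    ∫ θ in (π / 2 - α)..(5 * π / 6 - α),
        (5 * π / 12 - √3 / 8 - α + sin α * cos α + cos α ^ 2 * sin (2 * θ) - cos α * cos θ)
      = 5 * π ^ 2 / 36 - √3 * π / 24 - π / 3 * α + π / 3 * (sin α * cos α)
        - 3 / 2 * cos α ^ 4 + 5 / 4 * cos α ^ 2 + √3 / 2 * (cos α ^ 3 * sin α)
        - √3 / 2 * (sin α * cos α) := by
  have hderiv : ∀ θ ∈ uIcc (π / 2 - α) (5 * π / 6 - α), HasDerivAt
      (fun θ : ℝ => (5 * π / 12 - √3 / 8 - α + sin α * cos α) * θ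
        - cos α ^ 2 / 2 * cos (2 * θ) - cos α * sin θ)
      (5 * π / 12 - √3 / 8 - α + sin α * cos α + cos α ^ 2 * sin (2 * θ) - cos α * cos θ) θ := by
    intro θ _
    have h1 := (hasDerivAt_id' θ).const_mul (5 * π / 12 - √3 / 8 - α + sin α * cos α)
    have h2 : HasDerivAt (fun θ : ℝ => cos (2 * θ)) (-sin (2 * θ) * 2) θ :=
      (hasDerivAt_cos (2 * θ)).comp θ (by simpa using (hasDerivAt_id' θ).const_mul 2)
    have h3 := hasDerivAt_sin θ
    have key := (h1.fun_sub (h2.const_mul (cos α ^ 2 / 2))).fun_sub (h3.const_mul (cos α))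
    refine key.congr_deriv ?_
    ring
  rw [integral_eq_sub_of_hasDerivAt hderiv (Continuous.intervalIntegrable (by fun_prop) _ _)]
  have e1 : cos (2 * (5 * π / 6 - α)) = 1 / 2 * cos (2 * α) - √3 / 2 * sin (2 * α) := by
    rw [show 2 * (5 * π / 6 - α) = 5 * π / 3 - 2 * α by ring, cos_five_pi_div_three_sub]
  have e2 : cos (2 * (π / 2 - α)) = -cos (2 * α) := by
    rw [show 2 * (π / 2 - α) = π - 2 * α by ring, cos_pi_sub]
  have e3 : sin (π / 2 - α) = cos α := sin_pi_div_two_sub α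
  simp only [e1, e2, e3, sin_five_pi_div_six_sub]
  simp only [cos_two_mul, sin_two_mul]
  ring

/-- Antiderivative for the `α`-integral. [folklore] -/
theorem hasDerivAt_cornerAlphaPrim (α : ℝ) :
    HasDerivAt (fun α : ℝ =>
        (5 * π ^ 2 / 18 - √3 * π / 12) * sin α ^ 2 + π / 3 * α * (cos α ^ 2 - sin α ^ 2)
          - π / 3 * (sin α * cos α) + (π / 6 - √3 / 8) * α
          + (√3 / 8 - π / 6) * (sin α * cos α * (cos α ^ 2 - sin α ^ 2))
          + cos α ^ 6 - 5 / 4 * cos α ^ 4 + √3 / 3 * (sin α ^ 3 * cos α ^ 3))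
      (4 * sin α * cos α * (5 * π ^ 2 / 36 - √3 * π / 24 - π / 3 * α + π / 3 * (sin α * cos α)
        - 3 / 2 * cos α ^ 4 + 5 / 4 * cos α ^ 2 + √3 / 2 * (cos α ^ 3 * sin α)
        - √3 / 2 * (sin α * cos α))) α := by
  have hs := hasDerivAt_sin α
  have hc := hasDerivAt_cos α
  have hid := hasDerivAt_id' α
  have hs2 : HasDerivAt (fun α : ℝ => sin α ^ 2) (2 * sin α * cos α) α := by
    simpa using hs.fun_pow 2
  have hc2 : HasDerivAt (fun α : ℝ => cos α ^ 2) (2 * cos α * (-sin α)) α := by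
    simpa using hc.fun_pow 2
  have hs3 : HasDerivAt (fun α : ℝ => sin α ^ 3) (3 * sin α ^ 2 * cos α) α := by
    simpa using hs.fun_pow 3
  have hc3 : HasDerivAt (fun α : ℝ => cos α ^ 3) (3 * cos α ^ 2 * (-sin α)) α := by
    simpa using hc.fun_pow 3
  have hc4 : HasDerivAt (fun α : ℝ => cos α ^ 4) (4 * cos α ^ 3 * (-sin α)) α := by
    simpa using hc.fun_pow 4
  have hc6 : HasDerivAt (fun α : ℝ => cos α ^ 6) (6 * cos α ^ 5 * (-sin α)) α := by
    simpa using hc.fun_pow 6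
  have hcs : HasDerivAt (fun α : ℝ => cos α ^ 2 - sin α ^ 2)
      (2 * cos α * (-sin α) - 2 * sin α * cos α) α := hc2.sub hs2
  have hsc : HasDerivAt (fun α : ℝ => sin α * cos α) (cos α * cos α + sin α * (-sin α)) α :=
    hs.mul hc
  have key := (((((((hs2.const_mul (5 * π ^ 2 / 18 - √3 * π / 12)).fun_add
    ((hid.const_mul (π / 3)).fun_mul hcs)).fun_sub (hsc.const_mul (π / 3))).fun_add
    (hid.const_mul (π / 6 - √3 / 8))).fun_add ((hsc.fun_mul hcs).const_mul (√3 / 8 - π / 6))).fun_add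
    hc6).fun_sub (hc4.const_mul (5 / 4))).fun_add ((hs3.fun_mul hc3).const_mul (√3 / 3))
  refine key.congr_deriv ?_
  linear_combination (-((π / 6 - √3 / 8) * (1 + sin α ^ 2 + cos α ^ 2)
    + √3 * sin α ^ 2 * cos α ^ 2)) * sin_sq_add_cos_sq α

/-- The `α`-integral: the corner constant `1/16 + √3π/48 − π²/72`. [folklore] -/
theorem integral_corner_alpha :
    ∫ α in (π / 3)..(π / 2), 4 * sin α * cos α * (5 * π ^ 2 / 36 - √3 * π / 24 - π / 3 * α
        + π / 3 * (sin α * cos α) - 3 / 2 * cos α ^ 4 + 5 / 4 * cos α ^ 2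
        + √3 / 2 * (cos α ^ 3 * sin α) - √3 / 2 * (sin α * cos α))
      = 1 / 16 + √3 * π / 48 - π ^ 2 / 72 := by
  rw [integral_eq_sub_of_hasDerivAt (fun α _ => hasDerivAt_cornerAlphaPrim α)
    (Continuous.intervalIntegrable (by fun_prop) _ _)]
  have h3 : √3 ^ 2 = 3 := sq_sqrt (by norm_num)
  simp only [sin_pi_div_two, cos_pi_div_two, sin_pi_div_three, cos_pi_div_three]
  linear_combination (√3 ^ 2 / 384 + π / 96 * √3 - π ^ 2 / 24) * h3

/-! ### Sign of the corner integrand and the corner-area integral -/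

/-- If `y ≤ sin(θ+α)` then the corner integrand
`√(1−y²) + 2cos α cos θ − √(1 − (y − 2cos α sin θ)²)` is nonnegative
(`0 ≤ θ, α ≤ π/2`, `θ + α ≥ π/2`, `0 ≤ y ≤ 1`). [folklore] -/
theorem corner_integrand_nonneg {θ α y : ℝ} (hθ0 : 0 ≤ θ) (hθ1 : θ ≤ π / 2) (hα0 : 0 ≤ α)
    (hα1 : α ≤ π / 2) (hsum : π / 2 ≤ θ + α) (hy0 : 0 ≤ y) (hy1 : y ≤ 1)
    (hyY : y ≤ sin (θ + α)) :
    0 ≤ √(1 - y ^ 2) + 2 * cos α * cos θ - √(1 - (y - 2 * cos α * sin θ) ^ 2) := by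
  have hπ := pi_pos
  set β := arcsin y with hβ
  have hβ0 : 0 ≤ β := arcsin_nonneg.mpr hy0
  have hβ1 : β ≤ π / 2 := arcsin_le_pi_div_two y
  have hsβ : sin β = y := sin_arcsin (by linarith) hy1
  have hcβ : cos β = √(1 - y ^ 2) := cos_arcsin y
  have hcosα : 0 ≤ cos α := cos_nonneg_of_neg_pi_div_two_le_of_le (by linarith) hα1
  have hcosθ : 0 ≤ cos θ := cos_nonneg_of_neg_pi_div_two_le_of_le (by linarith) hθ1
  have hβle : β ≤ π - (θ + α) := by
    rw [hβ, arcsin_le_iff_le_sin ⟨by linarith, hy1⟩ ⟨by linarith, by linarith⟩, sin_pi_sub]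
    exact hyY
  have hcos : cos (π - (β + θ)) ≤ cos α :=
    cos_le_cos_of_nonneg_of_le_pi hα0 (by linarith) (by linarith)
  rw [cos_pi_sub, cos_add, hsβ, hcβ] at hcos
  have hw0 : 0 ≤ 1 - y ^ 2 := by nlinarith
  have hsq : √(1 - y ^ 2) ^ 2 = 1 - y ^ 2 := sq_sqrt hw0
  have hkey : 0 ≤ cos α * (cos α + √(1 - y ^ 2) * cos θ - y * sin θ) :=
    mul_nonneg hcosα (by linarith)
  have hexp : (√(1 - y ^ 2) + 2 * cos α * cos θ) ^ 2 - (1 - (y - 2 * cos α * sin θ) ^ 2)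
      = 4 * (cos α * (cos α + √(1 - y ^ 2) * cos θ - y * sin θ)) := by
    linear_combination hsq + (4 * cos α ^ 2) * sin_sq_add_cos_sq θ
  have hle : 1 - (y - 2 * cos α * sin θ) ^ 2 ≤ (√(1 - y ^ 2) + 2 * cos α * cos θ) ^ 2 := by
    linarith
  have hnn : 0 ≤ √(1 - y ^ 2) + 2 * cos α * cos θ := by positivity
  have := Real.sqrt_le_sqrt hle
  rw [sqrt_sq hnn] at this
  linarith

/-- If `sin(θ+α) ≤ y ≤ 1` then the corner integrand is nonpositive
(`0 ≤ θ, α ≤ π/2`, `θ + α ≥ π/2`, `0 ≤ y`). [folklore] -/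
theorem corner_integrand_nonpos {θ α y : ℝ} (hθ0 : 0 ≤ θ) (hθ1 : θ ≤ π / 2) (hα0 : 0 ≤ α)
    (hα1 : α ≤ π / 2) (hsum : π / 2 ≤ θ + α) (hy0 : 0 ≤ y) (hy1 : y ≤ 1)
    (hYy : sin (θ + α) ≤ y) :
    √(1 - y ^ 2) + 2 * cos α * cos θ - √(1 - (y - 2 * cos α * sin θ) ^ 2) ≤ 0 := by
  have hπ := pi_pos
  set β := arcsin y with hβ
  have hβ0 : 0 ≤ β := arcsin_nonneg.mpr hy0
  have hβ1 : β ≤ π / 2 := arcsin_le_pi_div_two y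
  have hsβ : sin β = y := sin_arcsin (by linarith) hy1
  have hcβ : cos β = √(1 - y ^ 2) := cos_arcsin y
  have hcosα : 0 ≤ cos α := cos_nonneg_of_neg_pi_div_two_le_of_le (by linarith) hα1
  have hcosθ : 0 ≤ cos θ := cos_nonneg_of_neg_pi_div_two_le_of_le (by linarith) hθ1
  have hβge : π - (θ + α) ≤ β := by
    rw [hβ, le_arcsin_iff_sin_le ⟨by linarith, by linarith⟩ ⟨by linarith, hy1⟩, sin_pi_sub]
    exact hYy
  have hcos : cos α ≤ cos (π - (β + θ)) :=
    cos_le_cos_of_nonneg_of_le_pi (by linarith) (by linarith) (by linarith)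
  rw [cos_pi_sub, cos_add, hsβ, hcβ] at hcos
  have hw0 : 0 ≤ 1 - y ^ 2 := by nlinarith
  have hsq : √(1 - y ^ 2) ^ 2 = 1 - y ^ 2 := sq_sqrt hw0
  have hkey : cos α * (cos α + √(1 - y ^ 2) * cos θ - y * sin θ) ≤ 0 :=
    mul_nonpos_of_nonneg_of_nonpos hcosα (by linarith)
  have hexp : (√(1 - y ^ 2) + 2 * cos α * cos θ) ^ 2 - (1 - (y - 2 * cos α * sin θ) ^ 2)
      = 4 * (cos α * (cos α + √(1 - y ^ 2) * cos θ - y * sin θ)) := by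
    linear_combination hsq + (4 * cos α ^ 2) * sin_sq_add_cos_sq θ
  have hle : (√(1 - y ^ 2) + 2 * cos α * cos θ) ^ 2 ≤ 1 - (y - 2 * cos α * sin θ) ^ 2 := by
    linarith
  have hnn : 0 ≤ √(1 - y ^ 2) + 2 * cos α * cos θ := by positivity
  have := Real.sqrt_le_sqrt hle
  rw [sqrt_sq hnn] at this
  linarith

/-- The corner area `∫_{1/2}^1 max(g, 0) dy` in the angle variables: for `π/3 < α < π/2`,
`π/2 − α < θ < π/2` it equals `F₁(θ, α) + Φ(1/2 − 2cos α sin θ)` if `θ + α < 5π/6` and `0`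
otherwise. [folklore] -/
theorem integral_corner_posPart_angle {θ α : ℝ} (hα1 : π / 3 < α) (hα2 : α < π / 2)
    (hθ1 : π / 2 - α < θ) (hθ2 : θ < π / 2) :
    ∫ y in (1 / 2 : ℝ)..1,
        max (√(1 - y ^ 2) + 2 * cos α * cos θ - √(1 - (y - 2 * cos α * sin θ) ^ 2)) 0 =
      if θ < 5 * π / 6 - α then
        5 * π / 12 - √3 / 8 - α + sin α * cos α + cos α ^ 2 * sin (2 * θ) - cos α * cos θ
          + ((1 / 2 - 2 * cos α * sin θ) * √(1 - (1 / 2 - 2 * cos α * sin θ) ^ 2)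
              + arcsin (1 / 2 - 2 * cos α * sin θ)) / 2
      else 0 := by
  have hπ := pi_pos
  have hθ0 : 0 ≤ θ := by linarith
  have hcosα : 0 ≤ cos α := cos_nonneg_of_neg_pi_div_two_le_of_le (by linarith) hα2.le
  have hcosα' : cos α < 1 / 2 := by
    rw [← cos_pi_div_three]
    exact cos_lt_cos_of_nonneg_of_le_pi (by linarith) (by linarith) hα1
  have hsinθ : 0 ≤ sin θ := sin_nonneg_of_nonneg_of_le_pi hθ0 (by linarith)
  have hsinθ1 : sin θ ≤ 1 := sin_le_one θ
  have hq2 : 0 ≤ 2 * cos α * sin θ := by positivity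
  have hq2' : 2 * cos α * sin θ ≤ 3 / 2 := by nlinarith
  have hint : ∀ a b : ℝ, IntervalIntegrable (fun y : ℝ =>
      max (√(1 - y ^ 2) + 2 * cos α * cos θ - √(1 - (y - 2 * cos α * sin θ) ^ 2)) 0)
      volume a b := fun a b => Continuous.intervalIntegrable (by fun_prop) _ _
  split_ifs with h
  · -- nonempty corner: split at `Y = sin(θ+α) ∈ (1/2, 1]`
    have hY1 : sin (θ + α) ≤ 1 := sin_le_one _
    have hY0 : 1 / 2 < sin (θ + α) := by
      rw [← sin_pi_sub, ← sin_pi_div_six]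
      exact sin_lt_sin_of_lt_of_le_pi_div_two (by linarith) (by linarith) (by linarith)
    rw [← integral_add_adjacent_intervals (hint (1 / 2) (sin (θ + α))) (hint (sin (θ + α)) 1)]
    have h1 : ∫ y in (1 / 2 : ℝ)..sin (θ + α),
        max (√(1 - y ^ 2) + 2 * cos α * cos θ - √(1 - (y - 2 * cos α * sin θ) ^ 2)) 0 =
        ∫ y in (1 / 2 : ℝ)..sin (θ + α),
          (√(1 - y ^ 2) + 2 * cos α * cos θ - √(1 - (y - 2 * cos α * sin θ) ^ 2)) := by
      apply integral_congr
      intro y hy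
      rw [uIcc_of_le hY0.le] at hy
      exact max_eq_left (corner_integrand_nonneg hθ0 hθ2.le (by linarith) hα2.le (by linarith)
        (by linarith [hy.1]) (by linarith [hy.2]) hy.2)
    have h2 : ∫ y in sin (θ + α)..(1 : ℝ),
        max (√(1 - y ^ 2) + 2 * cos α * cos θ - √(1 - (y - 2 * cos α * sin θ) ^ 2)) 0 =
        ∫ y in sin (θ + α)..(1 : ℝ), (0 : ℝ) := by
      apply integral_congr
      intro y hy
      rw [uIcc_of_le hY1] at hy
      exact max_eq_right (corner_integrand_nonpos hθ0 hθ2.le (by linarith) hα2.le (by linarith)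
        (by linarith [hy.1]) hy.2 hy.1)
    rw [h1, h2, intervalIntegral.integral_zero, add_zero, integral_cornerSection hY0.le hY1 hq2 hq2']
    have hcf := corner_closedForm hα1 hα2 hθ1 h
    linear_combination hcf
  · -- empty corner
    have h' : 5 * π / 6 - α ≤ θ := not_lt.mp h
    have h0 : ∫ y in (1 / 2 : ℝ)..1,
        max (√(1 - y ^ 2) + 2 * cos α * cos θ - √(1 - (y - 2 * cos α * sin θ) ^ 2)) 0 =
        ∫ y in (1 / 2 : ℝ)..1, (0 : ℝ) := by
      apply integral_congr
      intro y hy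
      rw [uIcc_of_le (by norm_num : (1 / 2 : ℝ) ≤ 1)] at hy
      have hY : sin (θ + α) ≤ 1 / 2 := by
        rw [← sin_pi_sub, ← sin_pi_div_six]
        exact sin_le_sin_of_le_of_le_pi_div_two (by linarith) (by linarith) (by linarith)
      exact max_eq_right (corner_integrand_nonpos hθ0 hθ2.le (by linarith) hα2.le (by linarith)
        (by linarith [hy.1]) hy.2 (by linarith [hy.1]))
    rw [h0, intervalIntegral.integral_zero]

/-- The corner area in polar variables `q = r (cos θ, sin θ)`, `0 < r < 1`, `0 < θ < π/2`,
`r < 2 sin θ` (that is `q` in the right half of the thin lens): `∫_{1/2}^1 max(g, 0) dy` with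
`g(y) = √(1−y²) + r cos θ − √(1 − (y − r sin θ)²)`, evaluated at `α = arccos(r/2)`. [folklore] -/
theorem integral_corner_posPart {r θ : ℝ} (hr0 : 0 < r) (hr1 : r < 1) (hθ0 : 0 < θ)
    (hθ2 : θ < π / 2) (hrθ : r < 2 * sin θ) :
    ∫ y in (1 / 2 : ℝ)..1, max (√(1 - y ^ 2) + r * cos θ - √(1 - (y - r * sin θ) ^ 2)) 0 =
      if θ < 5 * π / 6 - arccos (r / 2) then
        5 * π / 12 - √3 / 8 - arccos (r / 2) + sin (arccos (r / 2)) * cos (arccos (r / 2))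
          + cos (arccos (r / 2)) ^ 2 * sin (2 * θ) - cos (arccos (r / 2)) * cos θ
          + ((1 / 2 - r * sin θ) * √(1 - (1 / 2 - r * sin θ) ^ 2)
              + arcsin (1 / 2 - r * sin θ)) / 2
      else 0 := by
  have hπ := pi_pos
  have hca : cos (arccos (r / 2)) = r / 2 := cos_arccos (by linarith) (by linarith)
  have hα2 : arccos (r / 2) < π / 2 := arccos_lt_pi_div_two.mpr (by linarith)
  have hα1 : π / 3 < arccos (r / 2) := by
    rw [← arccos_cos (by linarith : 0 ≤ π / 3) (by linarith), cos_pi_div_three]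
    exact strictAntiOn_arccos ⟨by linarith, by linarith⟩ ⟨by norm_num, by norm_num⟩ (by linarith)
  have hθ1 : π / 2 - arccos (r / 2) < θ := by
    by_contra hcon
    have hcon' : arccos (r / 2) ≤ π / 2 - θ := by linarith [not_lt.mp hcon]
    have h1 : cos (π / 2 - θ) ≤ cos (arccos (r / 2)) :=
      cos_le_cos_of_nonneg_of_le_pi (arccos_nonneg _) (by linarith) hcon'
    rw [cos_pi_div_two_sub, hca] at h1
    linarith
  have h2r : 2 * cos (arccos (r / 2)) = r := by rw [hca]; ring
  have key := integral_corner_posPart_angle hα1 hα2 hθ1 hθ2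
  rw [h2r] at key
  exact key

/-- The radial corner integral: substituting `r = 2cos α` in `∫₀¹ r · I(arccos(r/2)) dr` gives the
`α`-integral `integral_corner_alpha`, i.e. the corner constant `1/16 + √3π/48 − π²/72`.
[folklore] -/
theorem integral_corner_r :
    ∫ r in (0 : ℝ)..1, r * (5 * π ^ 2 / 36 - √3 * π / 24 - π / 3 * arccos (r / 2)
        + π / 3 * (sin (arccos (r / 2)) * cos (arccos (r / 2))) - 3 / 2 * cos (arccos (r / 2)) ^ 4
        + 5 / 4 * cos (arccos (r / 2)) ^ 2
        + √3 / 2 * (cos (arccos (r / 2)) ^ 3 * sin (arccos (r / 2)))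
        - √3 / 2 * (sin (arccos (r / 2)) * cos (arccos (r / 2))))
      = 1 / 16 + √3 * π / 48 - π ^ 2 / 72 := by
  have hπ := pi_pos
  have hderiv : ∀ x ∈ uIcc (π / 2) (π / 3), HasDerivAt (fun u : ℝ => 2 * cos u) (-2 * sin x) x := by
    intro x _
    have h := (hasDerivAt_cos x).const_mul 2
    refine h.congr_deriv ?_
    ring
  have hcont : ContinuousOn (fun x : ℝ => -2 * sin x) (uIcc (π / 2) (π / 3)) :=
    Continuous.continuousOn (by fun_prop)
  have hg : Continuous (fun r : ℝ => r * (5 * π ^ 2 / 36 - √3 * π / 24 - π / 3 * arccos (r / 2)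
        + π / 3 * (sin (arccos (r / 2)) * cos (arccos (r / 2))) - 3 / 2 * cos (arccos (r / 2)) ^ 4
        + 5 / 4 * cos (arccos (r / 2)) ^ 2
        + √3 / 2 * (cos (arccos (r / 2)) ^ 3 * sin (arccos (r / 2)))
        - √3 / 2 * (sin (arccos (r / 2)) * cos (arccos (r / 2))))) := by
    fun_prop
  have key := integral_comp_mul_deriv (f := fun u : ℝ => 2 * cos u) (f' := fun x : ℝ => -2 * sin x)
    (g := fun r : ℝ => r * (5 * π ^ 2 / 36 - √3 * π / 24 - π / 3 * arccos (r / 2)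
        + π / 3 * (sin (arccos (r / 2)) * cos (arccos (r / 2))) - 3 / 2 * cos (arccos (r / 2)) ^ 4
        + 5 / 4 * cos (arccos (r / 2)) ^ 2
        + √3 / 2 * (cos (arccos (r / 2)) ^ 3 * sin (arccos (r / 2)))
        - √3 / 2 * (sin (arccos (r / 2)) * cos (arccos (r / 2))))) hderiv hcont hg
  simp only [Function.comp_def, cos_pi_div_two, mul_zero, cos_pi_div_three,
    show (2 : ℝ) * (1 / 2) = 1 by norm_num] at key
  rw [← key, integral_symm, ← intervalIntegral.integral_neg, ← integral_corner_alpha]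
  apply integral_congr
  intro x hx
  rw [uIcc_of_le (by linarith)] at hx
  have h1 : arccos (2 * cos x / 2) = x := by
    rw [show 2 * cos x / 2 = cos x by ring, arccos_cos (by linarith [hx.1]) (by linarith [hx.2])]
  simp only [h1]
  ring

end HardDiscB4

end Literature.MathematicalPhysics.StatisticalMechanics

end
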